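import Mathlib
import Summits.NavierStokesRegularity.NavierStokesRegularity.Theorems.TaoLadderRungTwoFlatTruncatedHop
import Summits.NavierStokesRegularity.NavierStokesRegularity.Theorems.TaoLadderRungTwoFlatNonlinearHopForcedTwoGauge
import HarnessLib

/-!
# The localised hop estimate behind a captured pulse with the interface input read in the CONTRACTION gauge
  (junk race L8b-3 / kill point (K3), assembled at λ₀ = 1) (helper for stmt-NavierStokesRegularity-23908
  `MirrorSolitaryWave` and stmt-…-23909 `GradedAdiabaticWake`; route TaoLadderRungTwoFlat; cell harvest/h2-tao-ladder,
  p1 g21; HOP-INVARIANT-50 §4 (K3))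

* `geomGauge_succ`, `geomGauge_le_succ`, `geomGauge_succ_le`, `geomGauge_le_shift`, `isWindowRegular_geomGauge` — the
  geometric gauge `ω = geomGauge g b` (`g, b ≥ 1`) is monotone in the shell and window-regular with `Λ' = max g b`;
* `truncated_hop_estimate₂` — as `MirrorPulse.truncated_hop_estimate`, but the interface forcing enters only through
  its `ω`-size `Fω = sup ω·|interfaceForcing|` (the head-gauge size `F` still enters the a-priori radius `R`):
  `ω_{i,k}|η_{i,k+N}(Nτ) − c₁Φ̇ − c₂Φ| ≤ ρB + (‖T♭‖₁g·R² + Fω)·Nτ·e^{2‖T♭‖₁M(max g b)Nτ}`. With the edge `K` shells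
  behind the core, `ω = b^{−K}` at the interface: the near → core entry of theory-1's two-zone loop is
  `m₂₁ = O(b^{−K})` — the `e^{−cK}` of HOP-INVARIANT-50 §4 (K3), now a kernel constant.

HONEST FRAMING: a conditional estimate about a MODEL lattice (Tao 2016 §4 vocabulary on `S♭`); the pulse, (S2) and all
bounds are HYPOTHESES; nothing certified; nothing about the Navier–Stokes equations.
-/

noncomputable section

-- the sub-problem namespace repeats the summit name by design (D-0017)
set_option linter.dupNamespace false

namespace Summit.NavierStokesRegularity.NavierStokesRegularity.Theorems

open Set Filter Literature.Analysis.FluidPDE Literature.Analysis.FluidPDE.TaoCascade QuadPolar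
open scoped Topology

namespace MirrorPulse

/-! ### The geometric gauge is monotone and window-regular -/

/-- One step of the geometric gauge: `ω_{k+1} = g·ω_k` ahead (`k ≥ 0`), `ω_{k+1} = b·ω_k` behind (`k < 0`), `b ≠ 0`.
[folklore] -/
theorem geomGauge_succ {g b : ℝ} (hb : b ≠ 0) (i : Fin 2) (k : ℤ) :
    geomGauge g b i (k + 1) = (if 0 ≤ k then g else b) * geomGauge g b i k := by
  unfold geomGauge
  rcases le_or_gt 0 k with hk | hk
  · rw [if_pos hk]
    have e1 : (k + 1).toNat = k.toNat + 1 := by omega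
    have e2 : (-(k + 1)).toNat = 0 := by omega
    have e3 : (-k).toNat = 0 := by omega
    rw [e1, e2, e3, pow_succ, pow_zero, inv_one]
    ring
  · rw [if_neg (not_le.mpr hk)]
    have e1 : (k + 1).toNat = 0 := by omega
    have e2 : k.toNat = 0 := by omega
    have e3 : (-k).toNat = (-(k + 1)).toNat + 1 := by omega
    rw [e1, e2, e3, pow_zero, pow_succ, mul_inv]
    field_simp

/-- The geometric gauge is non-decreasing in the shell (`g, b ≥ 1`). [folklore] -/
theorem geomGauge_le_succ {g b : ℝ} (hg : 1 ≤ g) (hb : 1 ≤ b) (i : Fin 2) (k : ℤ) :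
    geomGauge g b i k ≤ geomGauge g b i (k + 1) := by
  rw [geomGauge_succ (by linarith) i k]
  have hpos : 0 < geomGauge g b i k := geomGauge_pos (by linarith) (by linarith) i k
  have hfac : 1 ≤ (if 0 ≤ k then g else b) := by split_ifs <;> assumption
  exact le_mul_of_one_le_left hpos.le hfac

/-- … and grows by at most `max g b` per shell. [folklore] -/
theorem geomGauge_succ_le {g b : ℝ} (hg : 1 ≤ g) (hb : 1 ≤ b) (i : Fin 2) (k : ℤ) :
    geomGauge g b i (k + 1) ≤ max g b * geomGauge g b i k := by
  rw [geomGauge_succ (by linarith) i k]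
  have hpos : 0 < geomGauge g b i k := geomGauge_pos (by linarith) (by linarith) i k
  have hfac : (if 0 ≤ k then g else b) ≤ max g b := by
    split_ifs
    · exact le_max_left _ _
    · exact le_max_right _ _
  exact mul_le_mul_of_nonneg_right hfac hpos.le

/-- Monotone shift domination `ω_k ≤ ω_{k+N}` (`g, b ≥ 1`): the geometric gauge is shift-regular with `Γ = 1`.
[folklore] -/
theorem geomGauge_le_shift {g b : ℝ} (hg : 1 ≤ g) (hb : 1 ≤ b) (i : Fin 2) (k : ℤ) (N : ℕ) :
    geomGauge g b i k ≤ geomGauge g b i (k + N) := by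
  induction N with
  | zero => simp
  | succ n ih =>
    calc geomGauge g b i k ≤ geomGauge g b i (k + n) := ih
      _ ≤ geomGauge g b i (k + n + 1) := geomGauge_le_succ hg hb i (k + n)
      _ = geomGauge g b i (k + (n + 1 : ℕ)) := by push_cast; ring_nf

/-- **The geometric gauge is window-regular with `Λ' = max g b`** (`g, b ≥ 1`). [folklore] -/
theorem isWindowRegular_geomGauge {g b : ℝ} (hg : 1 ≤ g) (hb : 1 ≤ b) :
    QuadPolar.IsWindowRegular (geomGauge g b) (max g b) := by
  have hΛ : 1 ≤ max g b := le_max_of_le_left hg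
  refine ⟨fun i k => geomGauge_pos (by linarith) (by linarith) i k, hΛ, ?_⟩
  intro i j n k hk
  -- the gauge is species-uniform
  have hspec : ∀ k', geomGauge g b i k' = geomGauge g b j k' := fun k' => rfl
  have hpos : ∀ k', 0 < geomGauge g b j k' := fun k' => geomGauge_pos (by linarith) (by linarith) j k'
  rw [hspec]
  rcases hk with ⟨h1, h2⟩
  rcases lt_trichotomy k n with hlt | heq | hgt
  · -- k = n - 1
    have hkn : k = n - 1 := by omega
    have h := geomGauge_succ_le hg hb j k
    rw [hkn, sub_add_cancel] at h
    rw [hkn]; exact h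
  · subst heq
    exact le_mul_of_one_le_left (hpos k).le hΛ
  · -- k = n + 1
    have hkn : k = n + 1 := by omega
    subst hkn
    calc geomGauge g b j n ≤ geomGauge g b j (n + 1) := geomGauge_le_succ hg hb j n
      _ ≤ max g b * geomGauge g b j (n + 1) := le_mul_of_one_le_left (hpos _).le hΛ

/-! ### The localised hop estimate with the interface input in the contraction gauge -/

/-- **THE LOCALISED HOP ESTIMATE, TWO GAUGES (L8b-3 / (K3) at λ₀ = 1).** See the module docstring.
[cite: Tao2016AveragedNS, §4 (4.8) and §6.3–6.4 (statement shape); route TaoLadderRungTwoFlat, transfer lemma L8b-3 / (K3) (HOP-INVARIANT-50 §4)] -/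
theorem truncated_hop_estimate₂ {ε τ : ℝ} {Φ X : Fin 2 → ℤ → ℝ → ℝ} {g b ρ C M B B' F Fω : ℝ} {N : ℕ} {e : ℤ}
    (hΦ : IsGlobalSol ε Φ) (hX : IsGlobalSol ε X) (hτ : 0 ≤ τ)
    (hΦb : ∀ i n t, |Φ i n t| ≤ M) (hXb : ∀ i n t, |X i n t| ≤ M) (hg : 1 ≤ g) (hb : 1 ≤ b)
    (hS2 : HopContractionWith ε τ Φ (geomGauge g b) ρ C N)
    (hB : ∀ i k, geomGauge g b i k * |truncFam e (X - Φ) i k 0| ≤ B)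
    (hB' : ∀ i k, headGauge g i k * |truncFam e (X - Φ) i k 0| ≤ B') (hF : 0 ≤ F)
    (hfb : ∀ j k, ∀ t ∈ Icc 0 ((N : ℝ) * τ), headGauge g j k * |interfaceForcing ε 0 e Φ (X - Φ) j k t| ≤ F)
    (hFω : 0 ≤ Fω)
    (hfω : ∀ j k, ∀ t ∈ Icc 0 ((N : ℝ) * τ), geomGauge g b j k * |interfaceForcing ε 0 e Φ (X - Φ) j k t| ≤ Fω) :
    ∃ c₁ c₂ : ℝ, |c₁| ≤ C * B ∧ |c₂| ≤ C * B ∧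
      ∀ (i : Fin 2) (k : ℤ), geomGauge g b i k *
          |truncFam e (X - Φ) i (k + N) (N * τ)
            - c₁ * quadTermOn shiftSetFlat 0 (mirrorTable ε ε) Φ i (k + N) (N * τ)
            - c₂ * Φ i (k + N) (N * τ)| ≤
        ρ * B + 1 * ((tableAbsSum shiftSetFlat (mirrorTable ε ε) * g *
            ((B' + F * (N * τ)) * Real.exp (2 * tableAbsSum shiftSetFlat (mirrorTable ε ε) * M * g * (N * τ))) ^ 2
            + Fω) * (N * τ) *
              Real.exp (2 * tableAbsSum shiftSetFlat (mirrorTable ε ε) * M * max g b * (N * τ))) := by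
  obtain ⟨hωpos, -, -, -, -, hbody⟩ := hS2
  set u : Fin 2 → ℤ → ℝ → ℝ := X - Φ with hu
  have hΦu : Φ + u = X := by rw [hu]; abel
  have hT : 0 ≤ (N : ℝ) * τ := by positivity
  have hw : IsWindowRegular (headGauge g) g := isWindowRegular_headGauge hg
  have hA : IsWindowAdmissible (headGauge g) g := isWindowAdmissible_headGauge hg
  have hω : IsWindowRegular (geomGauge g b) (max g b) := isWindowRegular_geomGauge hg hb
  have hωw : ∀ i k, geomGauge g b i k ≤ headGauge g i k := fun i k =>
    geomGauge_le_headGauge (by linarith) hb i k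
  have hΓ : ∀ i k, geomGauge g b i k ≤ 1 * geomGauge g b i (k + (N : ℤ)) := fun i k => by
    rw [one_mul]; exact geomGauge_le_shift hg hb i k N
  have hΦc : ∀ i k, Continuous (Φ i k) := fun i k => hΦ.continuous i k
  have huc : ∀ i k, Continuous (u i k) := fun i k => by
    have h : Continuous fun t => X i k t - Φ i k t := (hX.continuous i k).sub (hΦ.continuous i k)
    exact h
  have hηc : ∀ j k, Continuous (truncFam e u j k) := continuous_truncFam huc
  have hXb' : ∀ i k t, |(Φ + u) i k t| ≤ M := by rw [hΦu]; exact hXb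
  have hXηb : ∀ i k t, |(Φ + truncFam e u) i k t| ≤ M := abs_add_truncFam_le hΦb hXb'
  have hfc : ∀ j k, Continuous (interfaceForcing ε 0 e Φ u j k) := continuous_interfaceForcing hΦc huc
  have hη : ∀ i n t, HasDerivAt (truncFam e u i n)
      (quadTermOn shiftSetFlat 0 (mirrorTable ε ε) (Φ + truncFam e u) i n t
        - quadTermOn shiftSetFlat 0 (mirrorTable ε ε) Φ i n t + interfaceForcing ε 0 e Φ u i n t) t := by
    intro i n t
    refine hasDerivAt_truncFam (fun j k => hΦ j k t) (fun j k => ?_) i n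
    rw [hΦu]; exact hX j k t
  have hlin : ∀ v : Fin 2 → ℤ → ℝ → ℝ,
      (∀ i n t, HasDerivAt (v i n) (linTermOn shiftSetFlat 0 (mirrorTable ε ε) Φ v i n t) t) →
      (∃ Mu : ℝ, ∀ i n, ∀ t ∈ Icc 0 ((N : ℝ) * τ), |v i n t| ≤ Mu) →
      (∀ i k, geomGauge g b i k * |v i k 0| ≤ B) →
        ∃ c₁ c₂ : ℝ, |c₁| ≤ C * B ∧ |c₂| ≤ C * B ∧
          ∀ i k, geomGauge g b i k * |v i (k + (N : ℤ)) ((N : ℝ) * τ)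
            - c₁ * quadTermOn shiftSetFlat 0 (mirrorTable ε ε) Φ i (k + (N : ℤ)) ((N : ℝ) * τ)
            - c₂ * Φ i (k + (N : ℤ)) ((N : ℝ) * τ)| ≤ ρ * B := by
    intro v hvd hvb hBv
    exact hbody v B ⟨hvd, hvb⟩ hBv
  exact nonlinear_hop_estimate_forced₂ isNearestNeighbourSet_shiftSetFlat (mirrorTable ε ε) hw hA hω hωw
    (N := (N : ℤ)) hΓ hT hΦ hηc hΦb hXηb hfc hfb hF hfω hFω hη hlin hB hB'

end MirrorPulse

end Summit.NavierStokesRegularity.NavierStokesRegularity.Theorems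

end
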